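import Summits.CriticalPhenomena.SAWScalingLimit.Theses.SAWRenewalTightness
import Literature.Probability.RandomPlanarGeometry.SAWRenewalBound

/-!
# `StripMassConservation` (route `SAWRenewalTightness`, item stmt-CriticalPhenomena-4734)

The critical mass of bridges of a given span is at most one: for every span `L ≥ 1` and every `N`,
`∑_{n ≤ N} ∑_{ω ∈ bridges 2 n, ω₁(n) = L} x_c^n ≤ 1`, where `x_c = 1/μ(ℤ²)` is the critical fugacity
(`SAW.criticalFugacity`) and `Zd.bridges 2 n` are the `n`-step vertex-function bridges from the
origin (`SAWBridges.lean`). This is the span-renewal inequality of Kesten (1963) / Madras–Slade (1993),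
§4.2, (4.2.9)–(4.2.12), at `z = z_c`.

**Proof** (word model of `SAWWords.lean` / `SAWWordBridges.lean`).
* `sum_pow_criticalFugacity_le_one` — Kraft's inequality at `x_c`: for every finite set `S` of
  irreducible bridges, `∑_{s ∈ S} x_c^{|s|} ≤ 1`. Indeed if the (continuous, polynomial) sum exceeded
  `1` at `x_c` it would exceed `1` at some `0 < z < x_c`, and Kesten's renewal lower bound
  `Renewal.le_connectiveConstant_of_kraft` (in tree) would give `z⁻¹ ≤ μ`, i.e. `x_c ≤ z`.
* `exists_irrBridge_append` — every non-empty self-avoiding bridge word is `s ++ t` with `s` an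
  irreducible bridge and `t` a bridge (cut at the least break point; Madras–Slade (4.2.1)–(4.2.2)).
* `bridgeWordMass_le_one` — the mass `M(N, L)` of bridge words of length `≤ N` and span `L` is `≤ 1`,
  by strong induction on `L`: the factorisation embeds the words of span `L ≥ 1` into pairs
  `(s, t)` with `span t = L - span s < L`, so `M(N, L) ≤ ∑_s x_c^{|s|} M(N, L - span s) ≤ ∑_s x_c^{|s|} ≤ 1`
  (the renewal equation (4.2.9) as an inequality; only `A(z_c) ≤ 1` is needed, not Kesten's identity).
* `card_bridges_filter_le` — vertex-function bridges of span `L` inject into bridge words of span `L`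
  (`wordOf` / `traj_wordOf` of `SAWWords.lean`), which transfers the bound to the route's statement.

Sources: H. Kesten, *On the number of self-avoiding walks*, J. Math. Phys. 4 (1963), §4;
N. Madras, G. Slade, *The Self-Avoiding Walk* (1993), §4.2, (4.2.1)–(4.2.12) and Prop. 4.1.8.
-/

open Finset Filter Topology
open Literature.Probability.LatticeModels
open Literature.Probability.RandomPlanarGeometry Literature.Probability.RandomPlanarGeometry.SAW
open scoped BigOperators Classical

namespace Summit.CriticalPhenomena.SAWScalingLimit.Theorems

namespace StripMass

/-! ## Kraft's inequality at the critical fugacity -/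

/-- `0 < x_c = 1/μ(ℤ²)` (`μ ≥ 1`). [folklore] -/
theorem criticalFugacity_pos : 0 < criticalFugacity := by
  have h := Zd.connectiveConstant_pos 2
  rw [Zd.connectiveConstant_two] at h
  exact inv_pos.2 h

/-- **Kraft's inequality at `x_c`**: for every finite set `S` of irreducible bridges,
`∑_{s ∈ S} x_c^{|s|} ≤ 1` (the finite form of `A(z_c) ≤ 1`, Madras–Slade (4.2.4), easy half).
If the sum exceeded `1` at `x_c`, by continuity it would exceed `1` at some `0 < z < x_c`, and
Kesten's renewal lower bound (`Renewal.le_connectiveConstant_of_kraft`) would force `z⁻¹ ≤ μ`.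
[cite: MadrasSlade1993, §4.2, eq. (4.2.4)] -/
theorem sum_pow_criticalFugacity_le_one {S : Finset (List Step)} (hS : Renewal.Admissible S) :
    ∑ s ∈ S, criticalFugacity ^ s.length ≤ 1 := by
  have hxc : 0 < criticalFugacity := criticalFugacity_pos
  have hμ : 0 < connectiveConstant := by
    have h := Zd.connectiveConstant_pos 2
    rwa [Zd.connectiveConstant_two] at h
  -- enlarge `S` by the one-step bridge `[+e₀]`
  set S' : Finset (List Step) := insert [(0 : Step)] S with hS'def
  have hS' : Renewal.Admissible S' := by
    intro s hs
    rcases Finset.mem_insert.1 hs with rfl | hs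
    · exact Renewal.isIrrBridge_single
    · exact hS s hs
  have hE : [(0 : Step)] ∈ S' := Finset.mem_insert_self _ _
  have hle : ∑ s ∈ S, criticalFugacity ^ s.length ≤ ∑ s ∈ S', criticalFugacity ^ s.length :=
    Finset.sum_le_sum_of_subset_of_nonneg (Finset.subset_insert _ _)
      fun _ _ _ => pow_nonneg hxc.le _
  refine hle.trans ?_
  by_contra hgt
  rw [not_le] at hgt
  -- the polynomial `z ↦ ∑ z^{|s|}` is continuous and `> 1` at `x_c`, hence `> 1` at some `0 < z < x_c`
  have hcont : Continuous fun z : ℝ => ∑ s ∈ S', z ^ s.length :=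
    continuous_finsetSum S' fun s _ => continuous_pow s.length
  have h1 : ∀ᶠ z in 𝓝 criticalFugacity, 1 < ∑ s ∈ S', z ^ s.length :=
    hcont.continuousAt.eventually (lt_mem_nhds hgt)
  have h2 : ∀ᶠ z in 𝓝[<] criticalFugacity,
      (1 < ∑ s ∈ S', z ^ s.length) ∧ z ∈ Set.Ioo 0 criticalFugacity :=
    (h1.filter_mono nhdsWithin_le_nhds).and (Ioo_mem_nhdsLT hxc)
  obtain ⟨z, hz1, hz0, hzlt⟩ := h2.exists
  -- Kesten's renewal bound with `ρ = z⁻¹`: `z⁻¹ ≤ μ`, contradicting `z < x_c = μ⁻¹`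
  have hK : 1 ≤ ∑ s ∈ S', z⁻¹⁻¹ ^ s.length := by
    rw [inv_inv]
    exact hz1.le
  have hρ := Renewal.le_connectiveConstant_of_kraft hS' hE (inv_pos.2 hz0) hK
  have hlt : connectiveConstant < z⁻¹ := by
    rw [← lt_inv_comm₀ hz0 hμ]
    exact hzlt
  exact absurd hρ (not_le.2 hlt)

/-! ## The first irreducible factor of a bridge -/

/-- A non-empty bridge has span `≥ 1`. [cite: MadrasSlade1993, Definition 1.2.4] -/
theorem one_le_xEnd_of_ne_nil {w : List Step} (hb : IsBridgeW w) (hne : w ≠ []) : 1 ≤ xEnd w := by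
  have h1 : 1 ≤ w.length := List.length_pos_iff.2 hne
  have := (isBridgeW_iff w).1 hb 1 le_rfl h1
  omega

/-- **Existence of the first irreducible factor**: a non-empty self-avoiding bridge word is
`s ++ t` with `s` an irreducible bridge and `t` a bridge — cut at the least break point (if there
is none the word is itself irreducible). [cite: MadrasSlade1993, §4.2, eq. (4.2.1)–(4.2.2)] -/
theorem exists_irrBridge_append {w : List Step} (hs : IsSAW w) (hb : IsBridgeW w) (hne : w ≠ []) :
    ∃ s t : List Step, s ++ t = w ∧ IsIrrBridge s ∧ IsBridgeW t := by
  by_cases hirr : IsIrreducible w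
  · exact ⟨w, [], List.append_nil w, ⟨hs, hb, hirr, hne⟩, isBridgeW_nil⟩
  · have hex : ∃ j, IsBreak w j := by
      by_contra h
      exact hirr fun j hj => h ⟨j, hj⟩
    -- the least break point `j`
    obtain ⟨j, hj, hmin⟩ : ∃ j, IsBreak w j ∧ ∀ j', j' < j → ¬ IsBreak w j' :=
      ⟨Nat.find hex, Nat.find_spec hex, fun j' h => Nat.find_min hex h⟩
    obtain ⟨hj0, hjl, hle, hgt⟩ := hj
    have hb' := (isBridgeW_iff w).1 hb
    have hlen : (w.take j).length = j := by
      rw [List.length_take, min_eq_left hjl.le]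
    have hxs : ∀ i ≤ j, xAt (w.take j) i = xAt w i := fun i hi => by
      show traj (w.take j) i 0 = traj w i 0
      rw [traj_take w hi]
    have hxt : ∀ k, xAt (w.drop j) k = xAt w (j + k) - xAt w j := fun k => by
      have := xAt_append_right (w.take j) (w.drop j) k
      rw [List.take_append_drop, xEnd, hlen, hxs j le_rfl] at this
      linarith
    refine ⟨w.take j, w.drop j, List.take_append_drop j w, ⟨hs.take j, ?_, ?_, ?_⟩, ?_⟩
    · -- the head is a bridge
      rw [isBridgeW_iff]
      intro i h1 h2
      rw [hlen] at h2
      rw [xEnd, hlen, hxs i h2, hxs j le_rfl]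
      exact ⟨(hb' i h1 (by omega)).1, hle i h2⟩
    · -- the head is irreducible: a break point of it would be a smaller break point of `w`
      intro j' hj'
      obtain ⟨h0', hj'l, hle', hgt'⟩ := hj'
      rw [hlen] at hj'l hgt'
      refine hmin j' hj'l ⟨h0', by omega, fun i hi => ?_, fun i hi1 hi2 => ?_⟩
      · have := hle' i hi
        rwa [hxs i (by omega), hxs j' hj'l.le] at this
      · rcases le_or_gt i j with hij | hij
        · have := hgt' i hi1 hij
          rwa [hxs j' hj'l.le, hxs i hij] at this
        · have h1 := hgt' j hj'l le_rfl
          rw [hxs j' hj'l.le, hxs j le_rfl] at h1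
          exact h1.trans (hgt i hij hi2)
    · -- the head is non-empty
      rw [ne_eq, ← List.length_eq_zero_iff, hlen]
      omega
    · -- the tail is a bridge
      rw [isBridgeW_iff]
      intro k h1 h2
      rw [List.length_drop] at h2
      have hjn : j + (w.length - j) = w.length := by omega
      rw [xEnd, List.length_drop, hxt k, hxt (w.length - j), hjn]
      refine ⟨sub_pos.2 (hgt (j + k) (by omega) (by omega)), sub_le_sub_right ?_ _⟩
      have := hb.xAt_le (j + k)
      rwa [xEnd] at this

/-! ## The renewal inequality: the critical mass of bridge words of span `L` is at most one -/

/-- Membership in the finite set of self-avoiding bridge words of length `≤ N` and span `L`.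
[folklore] -/
theorem mem_bridgeWords {N : ℕ} {L : ℤ} {w : List Step} :
    w ∈ (Finset.range (N + 1)).biUnion
        (fun n => (sawWords n).filter (fun w => IsBridgeW w ∧ xEnd w = L)) ↔
      w.length ≤ N ∧ IsSAW w ∧ IsBridgeW w ∧ xEnd w = L := by
  simp only [Finset.mem_biUnion, Finset.mem_range, Finset.mem_filter, mem_sawWords]
  constructor
  · rintro ⟨n, hn, ⟨hl, hs⟩, hb, hx⟩
    exact ⟨by omega, hs, hb, hx⟩
  · rintro ⟨hl, hs, hb, hx⟩
    exact ⟨w.length, by omega, ⟨rfl, hs⟩, hb, hx⟩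

/-- **Span renewal at `z_c`** (Madras–Slade (4.2.9)–(4.2.12) with `m(z_c) = 0`, as an
inequality): for every span `L` (here with `L.toNat = m`, for the induction) and every `N`, the
critical mass `∑ x_c^{|w|}` over self-avoiding bridge words `w` of length `≤ N` and span `L` is
`≤ 1`. For `L ≤ 0` only the empty word contributes; for `L ≥ 1` every word factors as `s ++ t`
(`exists_irrBridge_append`) with `span t = L - span s < L`, so the mass is at most
`∑_s x_c^{|s|} · 1 ≤ 1` by induction and `sum_pow_criticalFugacity_le_one`.
[cite: MadrasSlade1993, §4.2, eq. (4.2.9)–(4.2.12)] -/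
theorem bridgeWordMass_le_one_aux (m : ℕ) :
    ∀ (L : ℤ), L.toNat = m → ∀ N : ℕ,
      ∑ w ∈ (Finset.range (N + 1)).biUnion
          (fun n => (sawWords n).filter (fun w => IsBridgeW w ∧ xEnd w = L)),
        criticalFugacity ^ w.length ≤ 1 := by
  induction m using Nat.strong_induction_on with
  | _ m ih =>
  intro L hLm N
  have hxc : 0 < criticalFugacity := criticalFugacity_pos
  rcases le_or_gt L 0 with hL0 | hL1
  · -- `L ≤ 0`: only the empty word (a non-empty bridge has span `≥ 1`)
    have hsub : (Finset.range (N + 1)).biUnion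
        (fun n => (sawWords n).filter (fun w => IsBridgeW w ∧ xEnd w = L)) ⊆ {[]} := by
      intro w hw
      rw [Finset.mem_singleton]
      obtain ⟨-, -, hb, hx⟩ := mem_bridgeWords.1 hw
      by_contra hne
      have := one_le_xEnd_of_ne_nil hb hne
      omega
    calc ∑ w ∈ (Finset.range (N + 1)).biUnion
            (fun n => (sawWords n).filter (fun w => IsBridgeW w ∧ xEnd w = L)),
            criticalFugacity ^ w.length
        ≤ ∑ w ∈ ({[]} : Finset (List Step)), criticalFugacity ^ w.length :=
          Finset.sum_le_sum_of_subset_of_nonneg hsub fun _ _ _ => pow_nonneg hxc.le _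
      _ = 1 := by simp
  · -- `L ≥ 1`: factor at the first irreducible bridge
    -- the irreducible bridges of length `≤ N`
    set S : Finset (List Step) :=
      ((Finset.range (N + 1)).biUnion sawWords).filter (fun s => IsIrrBridge s) with hSdef
    have hS : Renewal.Admissible S := fun s hs => (Finset.mem_filter.1 hs).2
    -- every word of span `L` is `s ++ t`, `s ∈ S`, `t` a bridge word of span `L - span s`
    have hcover : (Finset.range (N + 1)).biUnion
        (fun n => (sawWords n).filter (fun w => IsBridgeW w ∧ xEnd w = L)) ⊆
        (S.sigma fun s => (Finset.range (N + 1)).biUnion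
          (fun n => (sawWords n).filter (fun w => IsBridgeW w ∧ xEnd w = L - xEnd s))).image
          (fun p => p.1 ++ p.2) := by
      intro w hw
      obtain ⟨hl, hsaw, hb, hx⟩ := mem_bridgeWords.1 hw
      have hne : w ≠ [] := by
        rintro rfl
        simp [xEnd] at hx
        omega
      obtain ⟨s, t, rfl, hsirr, ht⟩ := exists_irrBridge_append hsaw hb hne
      rw [List.length_append] at hl
      have hsS : s ∈ S := by
        refine Finset.mem_filter.2 ⟨Finset.mem_biUnion.2 ⟨s.length, ?_, mem_sawWords.2 ⟨rfl, hsirr.saw⟩⟩,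
          hsirr⟩
        rw [Finset.mem_range]
        omega
      have htT : t ∈ (Finset.range (N + 1)).biUnion
          (fun n => (sawWords n).filter (fun w => IsBridgeW w ∧ xEnd w = L - xEnd s)) := by
        refine mem_bridgeWords.2 ⟨by omega, ?_, ht, ?_⟩
        · have := hsaw.drop s.length
          rwa [List.drop_left] at this
        · rw [xEnd_append] at hx
          linarith
      exact Finset.mem_image.2 ⟨⟨s, t⟩, Finset.mem_sigma.2 ⟨hsS, htT⟩, rfl⟩
    calc ∑ w ∈ (Finset.range (N + 1)).biUnion
            (fun n => (sawWords n).filter (fun w => IsBridgeW w ∧ xEnd w = L)),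
            criticalFugacity ^ w.length
        ≤ ∑ w ∈ (S.sigma fun s => (Finset.range (N + 1)).biUnion
            (fun n => (sawWords n).filter (fun w => IsBridgeW w ∧ xEnd w = L - xEnd s))).image
            (fun p => p.1 ++ p.2), criticalFugacity ^ w.length :=
          Finset.sum_le_sum_of_subset_of_nonneg hcover fun _ _ _ => pow_nonneg hxc.le _
      _ ≤ ∑ p ∈ (S.sigma fun s => (Finset.range (N + 1)).biUnion
            (fun n => (sawWords n).filter (fun w => IsBridgeW w ∧ xEnd w = L - xEnd s))),
            criticalFugacity ^ (p.1 ++ p.2).length :=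
          Finset.sum_image_le_of_nonneg fun _ _ => pow_nonneg hxc.le _
      _ = ∑ s ∈ S, criticalFugacity ^ s.length * ∑ t ∈ (Finset.range (N + 1)).biUnion
            (fun n => (sawWords n).filter (fun w => IsBridgeW w ∧ xEnd w = L - xEnd s)),
              criticalFugacity ^ t.length := by
          rw [Finset.sum_sigma]
          simp only [List.length_append, pow_add, Finset.mul_sum]
      _ ≤ ∑ s ∈ S, criticalFugacity ^ s.length * 1 := by
          refine Finset.sum_le_sum fun s hs => mul_le_mul_of_nonneg_left ?_ (pow_nonneg hxc.le _)
          have hs1 : 1 ≤ xEnd s := one_le_xEnd_of_ne_nil (hS s hs).bridge (hS s hs).ne_nil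
          exact ih (L - xEnd s).toNat (by omega) (L - xEnd s) rfl N
      _ ≤ 1 := by
          simp only [mul_one]
          exact sum_pow_criticalFugacity_le_one hS

/-- The critical mass of self-avoiding bridge words of length `≤ N` and span `L` is at most one
(`bridgeWordMass_le_one_aux` without the induction parameter).
[cite: MadrasSlade1993, §4.2, eq. (4.2.9)–(4.2.12)] -/
theorem bridgeWordMass_le_one (L : ℤ) (N : ℕ) :
    ∑ w ∈ (Finset.range (N + 1)).biUnion
        (fun n => (sawWords n).filter (fun w => IsBridgeW w ∧ xEnd w = L)),
      criticalFugacity ^ w.length ≤ 1 :=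
  bridgeWordMass_le_one_aux L.toNat L rfl N

/-! ## Transfer to vertex-function bridges -/

/-- The `n`-step vertex-function bridges of span `L` (`Zd.bridges 2 n`, `ω₁(n) = L`) inject into
the self-avoiding bridge words of length `n` and span `L`, by reading off the step word
(`wordOf`, left inverse `traj_wordOf`). [cite: MadrasSlade1993, §1.1] -/
theorem card_bridges_filter_le (n : ℕ) (L : ℤ) :
    ((Zd.bridges 2 n).filter (fun ω => ω n 0 = L)).card ≤
      ((sawWords n).filter (fun w => IsBridgeW w ∧ xEnd w = L)).card := by
  refine Finset.card_le_card_of_injOn (fun ω => wordOf n ω) (fun ω hω => ?_) ?_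
  · rw [Finset.mem_coe, Finset.mem_filter, Zd.mem_bridges] at hω
    obtain ⟨⟨hω, hb⟩, hL⟩ := hω
    have hsaw : IsSAW (wordOf n ω) := by
      rw [isSAW_iff_injOn, traj_wordOf hω, length_wordOf]
      exact (Zd.mem_saws.1 hω).2.2.2
    rw [Finset.mem_coe, Finset.mem_filter, mem_sawWords]
    refine ⟨⟨length_wordOf n ω, hsaw⟩, ?_, ?_⟩
    · show Zd.IsBridge (wordOf n ω).length (traj (wordOf n ω))
      rw [length_wordOf, traj_wordOf hω]
      exact hb
    · show traj (wordOf n ω) (wordOf n ω).length 0 = L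
      rw [length_wordOf, traj_wordOf hω]
      exact hL
  · intro ω hω ω' hω' h
    rw [Finset.mem_coe, Finset.mem_filter, Zd.mem_bridges] at hω hω'
    have h' : wordOf n ω = wordOf n ω' := h
    calc ω = traj (wordOf n ω) := (traj_wordOf hω.1.1).symm
      _ = traj (wordOf n ω') := by rw [h']
      _ = ω' := traj_wordOf hω'.1.1

end StripMass

open StripMass in
/-- **`StripMassConservation`** (item stmt-CriticalPhenomena-4734 of route `SAWRenewalTightness`):
for every span `L ≥ 1` and every `N`, the critical mass of the vertex-function bridges from the
origin of span `L` and at most `N` steps is at most one,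
`∑_{n ≤ N} ∑_{ω ∈ Zd.bridges 2 n, ω₁(n) = L} x_c^n ≤ 1` — the span-renewal probability `u_L ≤ 1`
of Kesten's renewal structure at `z = z_c`. Transfer to bridge words (`card_bridges_filter_le`),
then `bridgeWordMass_le_one`. [cite: MadrasSlade1993, §4.2, eq. (4.2.9)–(4.2.12)] -/
theorem stripMassConservation_proof :
    Summit.CriticalPhenomena.SAWScalingLimit.Theses.SAWRenewalTightness.StripMassConservation := by
  unfold Summit.CriticalPhenomena.SAWScalingLimit.Theses.SAWRenewalTightness.StripMassConservation
  intro L _hL N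
  have hxc : 0 ≤ criticalFugacity := criticalFugacity_pos.le
  -- per length `n`: both inner sums are constant sums, compare the cardinalities
  have hstep : ∀ n : ℕ,
      ∑ _ω ∈ (Zd.bridges 2 n).filter (fun ω => ω n 0 = L), criticalFugacity ^ n ≤
        ∑ w ∈ (sawWords n).filter (fun w => IsBridgeW w ∧ xEnd w = L),
          criticalFugacity ^ w.length := by
    intro n
    have h2 : ∑ w ∈ (sawWords n).filter (fun w => IsBridgeW w ∧ xEnd w = L),
        criticalFugacity ^ w.length =
        ∑ _w ∈ (sawWords n).filter (fun w => IsBridgeW w ∧ xEnd w = L), criticalFugacity ^ n :=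
      Finset.sum_congr rfl fun w hw => by rw [(mem_sawWords.1 (Finset.mem_filter.1 hw).1).1]
    rw [h2, Finset.sum_const, Finset.sum_const, nsmul_eq_mul, nsmul_eq_mul]
    exact mul_le_mul_of_nonneg_right (Nat.cast_le.2 (card_bridges_filter_le n L)) (pow_nonneg hxc _)
  -- the sets of words of different lengths are disjoint
  have hdisj : Set.PairwiseDisjoint (↑(Finset.range (N + 1)) : Set ℕ)
      (fun n => (sawWords n).filter (fun w => IsBridgeW w ∧ xEnd w = L)) := by
    intro m _ n _ hmn
    rw [Function.onFun, Finset.disjoint_left]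
    intro w hwm hwn
    exact hmn ((mem_sawWords.1 (Finset.mem_filter.1 hwm).1).1.symm.trans
      (mem_sawWords.1 (Finset.mem_filter.1 hwn).1).1)
  refine (Finset.sum_le_sum fun n _ => hstep n).trans ?_
  rw [← Finset.sum_biUnion hdisj]
  exact bridgeWordMass_le_one L N

end Summit.CriticalPhenomena.SAWScalingLimit.Theorems
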